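/-
Copyright (c) 2026 the pub-hodgecm-mathlib formalisation cell (harness21).  Prover seat hodgecm-mathlib-K2E3-p23 (g7), routed to R90 section S2
(K2-lead ROUTING #7, 2026-09-04T16:24:31Z; S2 dealer K2E1b-plan (g7), STAGE-2 DEAL SHEET S2 v1 (W1-b) «S2-σ1»): the two members of the archimedean
A-packet of record are distinct — `jInfOfRecord p q t ≠ dsInfOfRecord p q t` — by the `z₀`-spectrum class invariant of ★ `K2E1bDSRecordLawDistinct`.
-/
import Summits.HodgeConjecture.HodgeConjecture.Theorems.K2E1bDSRecordLawDistinct   -- ★ (K2E4-p10): `exists_eigenvector_of_gkEquiv`, `exists_eigenvector_of_mem`, `exists_mem_of_eigenvector` (+ ★ #23 `K2E1bCarriersOfRecord`)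
import HarnessLib

/-!
# R90 ∕ S2 «archimedean packets», socket σ1 `stub_R90_S2_piN_ne_piS`: `πⁿ(ξ_∞) ≠ πˢ(ξ_∞)` IN ★ CARRIER CURRENCY —
# `jInfOfRecord_ne_dsInfOfRecord : ∀ p q t : ℤ, jInfOfRecord p q t ≠ dsInfOfRecord p q t`

Cell `pub/hodgecm-mathlib` (D-0151), crux H413 = `stmt-HodgeConjecture-24833` (`--supports … --as helper`; closes nothing by itself).  Pays the kit-free
socket σ1 of `Cruxes/H413/Lines/R90_S2_ArchPacketsB.lean` («`Π(ξ) = {πⁿ(ξ), πˢ(ξ)}` has TWO members at the real place», [Rogawski1990, §12.2 p. 174,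
§12.3 p. 178]) TOKEN FOR TOKEN; tie for B ED. 2: `theorem stub_R90_S2_piN_ne_piS … := jInfOfRecord_ne_dsInfOfRecord` (same namespace `…R90.S2`).
THEOREMS ONLY (no definition ∕ instance ∕ notation ∕ named fact ∕ `sorry`); imports ★ Theorems only (never a `Cruxes/…/Lines` module).

THE ARGUMENT (★ `K2E1bDSRecordLawDistinct`'s invariant, run on the two carriers of record).  Both classes are ★ `GKIrrClass.mk` of bundles built on
Kovačević structures of record with the SAME central twist `e = centralExp p q t` (★ `K2E1bCarriersOfRecord.jRepOfRecord ∕ dsRepOfRecord`: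
`σOfRecord (jDatumOfRecord (p+t)) e`, `σOfRecord (dsDatumOfRecord (p+t)) e`).  If the classes agree, a `(𝔤,K)`-equivalence (★ `GKIrrClass.mk_eq_mk_iff`)
transports the eigenvalues of `z₀ = i(E₁₁+E₂₂)`; on a structure of record these are exactly `{i(m+2e)∕3 : (n,m) ∈ 𝒟.S}` (★ §3), so every `z₀`-weight `m`
of a `K`-type of the `J`-carrier is a `z₀`-weight of a `K`-type of the square-integrable carrier (§1).  But with `s = p + t`: for `s ≤ −1` the `J`-carrier is
the ladder ray `rayNE (2s+1) (−s)` (`m = 3n + 2s + 1`, `n ≥ −s ≥ 1`) and the square-integrable carrier the wall ray `raySE (−(2s+1)) 1` (`m′ = −3n′ + 2s + 1`,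
`n′ ≥ 1`), so `m = m′` forces `n = −n′ < 0`; for `s ≥ 0` the rays are `raySE (−(2s+1)) (s+1)` (`m = −3n + 2s + 1`, `n ≥ 1`) and `rayNE (2s+1) 1`
(`m′ = 3n′ + 2s + 1`, `n′ ≥ 1`), again `n = −n′` — contradiction at the lowest `K`-type of the `J`-carrier (§2).  (This is print's «`J_φ^±` is not
square-integrable»: the `K`-type supports of the ladder and the wall representation are disjoint.)
[Rogawski1990, §12.3 p. 178] [BorelWallach2000, I §4.3; II §4.1] [Kovacevic2021, §3 Def. 1, §4 Thm. 4–5].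
HONEST LABEL: HC_CM is proved only modulo the 7 printed citations (2 remaining named inputs: hLiu418 = stmt-HodgeConjecture-24832, h413 =
stmt-HodgeConjecture-24833) until rung 0 closes; σ1 is a statement about the DEFINED carriers of record (Level A), count-neutral.

## References
* [Rogawski1990] J. Rogawski, *Automorphic Representations of Unitary Groups in Three Variables*, Annals of Math. Studies 123 (1990), §12.2 p. 174, §12.3 p. 178.
* [BorelWallach2000] A. Borel, N. Wallach, *Continuous Cohomology, Discrete Subgroups, and Representations of Reductive Groups*, 2nd ed. (2000), I §4.3, II §4.1.
* [Kovacevic2021] D. Kovačević, *Classification of irreducible unitary `(𝔤,K)`-modules of `SU(2,1)` via `K`-types* (2021), §3 Def. 1, §4 Thm. 4–5.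
-/

set_option autoImplicit false
set_option linter.dupNamespace false

noncomputable section

open Literature.NumberTheory.Automorphic
open Literature.RepresentationTheory
open Literature.RepresentationTheory.BorelWallach2000
open Literature.RepresentationTheory.Kovacevic2021 Literature.RepresentationTheory.Kovacevic2021.SU21Datum
open Summit.HodgeConjecture.HodgeConjecture.Cruxes.H413.K2E1bGKCohomologyU21 (centralExp)
open Summit.HodgeConjecture.HodgeConjecture.Cruxes.H413.K2E1bCarriersOfRecord
open Summit.HodgeConjecture.HodgeConjecture.Cruxes.H413.K2E1bDSRecordLawDistinct (exists_eigenvector_of_gkEquiv exists_eigenvector_of_mem exists_mem_of_eigenvector)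

namespace Summit.HodgeConjecture.HodgeConjecture.R90.S2

/-! ## §1 The `z₀`-weights of the `J`-carrier transport to the square-integrable carrier if the classes agree -/

/-- **Weight transport**: if `jInfOfRecord p q t = dsInfOfRecord p q t` then every `z₀`-weight `m` of a `K`-type `(n,m)` of the `J`-structure of record
`jDatumOfRecord (p+t)` is the `z₀`-weight of some `K`-type of the square-integrable structure `dsDatumOfRecord (p+t)` (same twist `centralExp p q t` on both
sides: ★ `GKIrrClass.mk_eq_mk_iff` gives a `(𝔤,K)`-equivalence, which transports the `z₀`-eigenvalue `i(m+2e)∕3`). [cite: BorelWallach2000, I §4.3]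
[cite: Kovacevic2021, §3 Def. 1] -/
theorem exists_dsWeight_of_eq {p q t : ℤ} (h : jInfOfRecord p q t = dsInfOfRecord p q t) {n m : ℤ}
    (hS : (n, m) ∈ (jDatumOfRecord (p + t)).S) :
    ∃ n' m' : ℤ, (n', m') ∈ (dsDatumOfRecord (p + t)).S ∧ m' = m := by
  rw [jInfOfRecord, dsInfOfRecord, GKIrrClass.mk_eq_mk_iff] at h
  obtain ⟨eqv⟩ := h
  obtain ⟨w, hw, hTw⟩ := exists_eigenvector_of_gkEquiv eqv (upqZ0 (Fin 2) (Fin 1)) _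
    (exists_eigenvector_of_mem (jDatumOfRecord (p + t)) (centralExp p q t) hS)
  obtain ⟨n', m', hS', hμ⟩ := exists_mem_of_eigenvector (dsDatumOfRecord (p + t)) (centralExp p q t) hw hTw
  refine ⟨n', m', hS', ?_⟩
  have h3 : ((m' : ℂ) + 2 * ((centralExp p q t : ℤ) : ℂ)) = ((m : ℂ) + 2 * ((centralExp p q t : ℤ) : ℂ)) := by
    have := mul_left_cancel₀ Complex.I_ne_zero hμ.symm
    field_simp at this
    linear_combination this
  exact_mod_cast (add_right_cancel h3 : (m' : ℂ) = (m : ℂ))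

/-! ## §2 The socket σ1: the two members of the archimedean packet of record are distinct -/

/-- **σ1 `stub_R90_S2_piN_ne_piS` PAID — `πⁿ(ξ_∞) ≠ πˢ(ξ_∞)` in ★ carrier currency**: `jInfOfRecord p q t ≠ dsInfOfRecord p q t` for every CM-dress
parameter `(p, q, t)`.  With `s = p + t`, the lowest `K`-type of the `J`-carrier (`(−s, −s + 1)` on `rayNE (2s+1) (−s)` if `s ≤ −1`, `(s+1, −s − 2)` on
`raySE (−(2s+1)) (s+1)` if `s ≥ 0`) has a `z₀`-weight that is not a `z₀`-weight of the square-integrable carrier (`raySE (−(2s+1)) 1` resp.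
`rayNE (2s+1) 1`: `3n = −3n′` with `n, n′ ≥ 1`), contradicting §1. [cite: Rogawski1990, §12.3 p. 178] [cite: Kovacevic2021, §4 Thm. 4–5]
[cite: BorelWallach2000, I §4.3] -/
theorem jInfOfRecord_ne_dsInfOfRecord : ∀ p q t : ℤ, jInfOfRecord p q t ≠ dsInfOfRecord p q t := by
  intro p q t h
  by_cases hs : p + t ≤ -1
  · -- `J` = north-east ladder ray from `n = −s`, square-integrable = south-east wall ray from `n′ = 1`
    have hS : ((-(p + t), 3 * (-(p + t)) + (2 * (p + t) + 1)) : ℤ × ℤ) ∈ (jDatumOfRecord (p + t)).S := by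
      rw [jDatumOfRecord_of_le hs]
      exact ⟨le_rfl, rfl⟩
    obtain ⟨n', m', hS', hm⟩ := exists_dsWeight_of_eq h hS
    rw [dsDatumOfRecord_of_le hs] at hS'
    obtain ⟨hn', hm'⟩ := hS'
    change (1 : ℤ) ≤ n' at hn'
    change m' = -(3 * n' + -(2 * (p + t) + 1)) at hm'
    omega
  · -- `J` = south-east ladder ray from `n = s + 1`, square-integrable = north-east wall ray from `n′ = 1`
    have hS : ((p + t + 1, -(3 * (p + t + 1) + -(2 * (p + t) + 1))) : ℤ × ℤ) ∈ (jDatumOfRecord (p + t)).S := by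
      rw [jDatumOfRecord_of_not_le hs]
      exact ⟨le_rfl, rfl⟩
    obtain ⟨n', m', hS', hm⟩ := exists_dsWeight_of_eq h hS
    rw [dsDatumOfRecord_of_not_le hs] at hS'
    obtain ⟨hn', hm'⟩ := hS'
    change (1 : ℤ) ≤ n' at hn'
    change m' = 3 * n' + (2 * (p + t) + 1) at hm'
    omega

end Summit.HodgeConjecture.HodgeConjecture.R90.S2

end
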